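import Summits.QuantumFields.YangMills.Theorems.IR.AfPincerUcPortBox
import Literature.Probability.LatticeModels.CoarseCellMixingDefectsBlockLeak
import Literature.Probability.LatticeModels.ONModelSpecification
import Literature.MathematicalPhysics.QuantumLattice.LatticeGaugeDLRBoxKernels
import Literature.MathematicalPhysics.QuantumFieldTheory.LatticeGaugeShenZhuZhuProofs
import Mathlib.MeasureTheory.Function.FactorsThrough

/-!
# The box instance of the defect engine for the `af-pincer-Uc` port: the box kernels form a block-Markov specification

Helper lemmas for item `stmt-QuantumFields-19354` (crux `IR`, line `af-pincer-Uc`, stub `stub_typCriterionUc`; architecture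
δ' of `MEMO-g6-port-map.md`, obligations P1 and P2 of its §3 table):

* §1 `isSpecification_boxSpec` (P1): the box kernels `boxSpec ρ β w x₀ m pad` — `ℤ⁴` Wilson kernels in the padded
  exterior, read on the box links — satisfy Georgii's four axioms: probability; measurability in the exterior
  (the `ℤ⁴` kernel is `𝓕_{Λᶜ}`-measurable and the padding map `boxExt` reads the exterior links only); properness
  (the `ℤ⁴` properness read on the box); consistency (the `ℤ⁴` consistency, after observing that a.e. under the outer
  kernel the configuration IS the padded extension of its restriction, both being `pad` off the box).
* §2 `hasBlockLeak_boxSpec` (P2): the instance is block-Markov (`HasBlockLeak … 0 r` for every `r`): two exteriors that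
  agree on the links whose label is within cyclic distance `1` of a label of the volume give the same kernel
  expectation to every observable reading the volume and the agreeing links — the Wilson interaction has range one
  (`exists_near_of_mem_collar`) and links at sup-distance `≤ 1` lie in cells at index distance `≤ 1` (`frame_hC1`).

HONEST FRAMING: bookkeeping for one stub of one open gap-crux of a CONDITIONAL chain; no claim about the crux or the gap.
-/

set_option autoImplicit false

noncomputable section

open MeasureTheory
open Literature.MathematicalPhysics.QuantumLattice
open Literature.MathematicalPhysics.QuantumFieldTheory (isSpecification_ymSpecification_of_t2Space)
open Literature.Probability.LatticeModels
open Summit.QuantumFields.YangMills.Cruxes.IR.Tempered (cellEdges regionEdges)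
open Summit.QuantumFields.YangMills.Cruxes.IR.CellTempered.Engine (frameCell frameCell_eq_iff frame_hC1)

namespace Summit.QuantumFields.YangMills.Cruxes.IR.AfPincerUc.Port

/-! ## §0 A cylinder-measurable function depends only on its cylinder coordinates (any codomain with measurable
singletons; the tree's `dependsOn_of_measurable_cylinderEvents` is the real-valued case) -/

/-- A `cylinderEvents Δ`-measurable function with values in a space with measurable singletons depends only on the
coordinates in `Δ` (Mathlib `Measurable.factorsThrough`). -/
theorem dependsOn_of_measurable_cylinderEvents' {V S Z : Type*} [MeasurableSpace S] [MeasurableSpace Z]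
    [MeasurableSingletonClass Z] {Δ : Set V} {g : (V → S) → Z}
    (hg : Measurable[cylinderEvents (X := fun _ : V => S) Δ] g) : DependsOn g Δ := by
  have hle : cylinderEvents (X := fun _ : V => S) Δ ≤
      MeasurableSpace.comap (Set.restrict Δ) (MeasurableSpace.pi) := by
    refine iSup₂_le fun i hi => ?_
    have : (fun σ : V → S => σ i) = (fun η : Δ → S => η ⟨i, hi⟩) ∘ Set.restrict Δ := rfl
    rw [this, ← MeasurableSpace.comap_comp]
    exact MeasurableSpace.comap_mono (measurable_pi_apply _).comap_le
  exact dependsOn_iff_factorsThrough.2 (hg.mono hle le_rfl).factorsThrough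

section Spec

variable {G : Type} [Group G] [TopologicalSpace G] [IsTopologicalGroup G] [CompactSpace G]
  [MeasurableSpace G] [BorelSpace G] [T2Space G] [SecondCountableTopology G]
variable {N : ℕ} (ρ : G →* Matrix (Fin N) (Fin N) ℂ) (hρ : Continuous ρ) (β : ℝ)
  {w : Fin 4 → ℤ → ℤ} (hw : ∀ i j, w i j + 1 ≤ w i (j + 1)) (x₀ : Fin 4 → ℤ) (m n : ℕ) (pad : LGConfig 4 G)

/-- Shorthand used in the statements below: the image of a set of box links in `ℤ⁴`. -/
private theorem mem_map_subtype_iff (A : Finset (BoxLink w x₀ m)) (e : ZdEdge 4) :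
    e ∈ A.map (Function.Embedding.subtype fun e => e ∈ boxEdges w x₀ m) ↔ ∃ h : e ∈ boxEdges w x₀ m, ⟨e, h⟩ ∈ A := by
  rw [Finset.mem_map]
  constructor
  · rintro ⟨v, hv, rfl⟩
    exact ⟨v.2, hv⟩
  · rintro ⟨h, hv⟩
    exact ⟨⟨e, h⟩, hv, rfl⟩

omit [Group G] [TopologicalSpace G] [IsTopologicalGroup G] [CompactSpace G] [MeasurableSpace G] [BorelSpace G]
  [T2Space G] [SecondCountableTopology G] in
/-- Box data agreeing off `A` have padded extensions agreeing off the image of `A`. -/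
theorem boxExt_eq_of_eqOn_compl (A : Finset (BoxLink w x₀ m)) {ζ ζ' : BoxLink w x₀ m → G}
    (h : ∀ v ∈ ((↑A : Set (BoxLink w x₀ m)))ᶜ, ζ v = ζ' v) :
    ∀ e ∈ ((↑(A.map (Function.Embedding.subtype fun e => e ∈ boxEdges w x₀ m)) : Set (ZdEdge 4)))ᶜ,
      boxExt w x₀ m pad ζ e = boxExt w x₀ m pad ζ' e := by
  intro e he
  by_cases heb : e ∈ boxEdges w x₀ m
  · rw [boxExt_apply_mem pad ζ heb, boxExt_apply_mem pad ζ' heb]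
    refine h ⟨e, heb⟩ fun hv => he ?_
    exact Finset.mem_coe.2 ((mem_map_subtype_iff x₀ m A e).2 ⟨heb, hv⟩)
  · exact boxExt_eq_of_not_mem pad ζ ζ' heb

omit [T2Space G] in
include hρ in
/-- The box kernel on a measurable set is a measurable function of the exterior (full product σ-algebra). -/
theorem measurable_boxSpec_apply (A : Finset (BoxLink w x₀ m)) {E : Set (BoxLink w x₀ m → G)}
    (hE : MeasurableSet E) : Measurable fun ζ => boxSpec ρ β w x₀ m pad A ζ E := by
  have h : (fun ζ => boxSpec ρ β w x₀ m pad A ζ E) = fun ζ =>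
      ymSpecification ρ β (A.map (Function.Embedding.subtype fun e => e ∈ boxEdges w x₀ m))
        (boxExt w x₀ m pad ζ) (boxRestrict w x₀ m ⁻¹' E) := by
    funext ζ
    exact boxSpec_apply ρ β w x₀ m pad A ζ hE
  rw [h]
  exact (measurable_ymSpecification_apply ρ hρ β _ (measurable_boxRestrict hE)).comp (measurable_boxExt pad)

include hρ in
/-- **P1 — the box kernels form a specification** (Georgii's axioms: probability, exterior measurability, properness,
consistency), from the `ℤ⁴` specification property of the Wilson kernels (`isSpecification_ymSpecification_of_t2Space`). -/
theorem isSpecification_boxSpec : IsSpecification (boxSpec ρ β w x₀ m pad) := by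
  classical
  have hγ := isSpecification_ymSpecification_of_t2Space (d := 4) ρ hρ β
  set ι : BoxLink w x₀ m ↪ ZdEdge 4 := Function.Embedding.subtype fun e => e ∈ boxEdges w x₀ m with hι
  refine ⟨fun A ζ => isProbabilityMeasure_boxSpec ρ β w x₀ m pad hρ A ζ, ?_, ?_, ?_⟩
  · -- exterior measurability
    intro A E hE
    have hfull : Measurable fun ζ => boxSpec ρ β w x₀ m pad A ζ E := measurable_boxSpec_apply ρ hρ β x₀ m pad A hE
    refine hfull.measurable_cylinderEvents_of_dependsOn ?_
    intro ζ ζ' hζ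
    have hdep := dependsOn_of_measurable_cylinderEvents'
      (hγ.measurable (A.map ι) (boxRestrict w x₀ m ⁻¹' E) (measurable_boxRestrict hE))
    simp only [boxSpec_apply ρ β w x₀ m pad A _ hE]
    exact hdep (boxExt_eq_of_eqOn_compl x₀ m pad A hζ)
  · -- properness
    intro A ζ
    have hprop := hγ.proper (A.map ι) (boxExt w x₀ m pad ζ)
    have hset : MeasurableSet {σ : BoxLink w x₀ m → G | ∀ v ∉ A, σ v = ζ v} := by
      have h : {σ : BoxLink w x₀ m → G | ∀ v ∉ A, σ v = ζ v} =
          ⋂ v ∈ (Finset.univ.filter fun v => v ∉ A), {σ | σ v = ζ v} := by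
        ext σ; simp
      rw [h]
      exact Finset.measurableSet_biInter _ fun v _ =>
        measurableSet_eq_fun (measurable_pi_apply v) measurable_const
    simp only [boxSpec]
    rw [ae_map_iff measurable_boxRestrict.aemeasurable hset]
    filter_upwards [hprop] with σ hσ
    intro v hv
    have hv' : v.1 ∉ A.map ι := fun h => hv (by
      obtain ⟨h1, h2⟩ := (mem_map_subtype_iff x₀ m A v.1).1 h
      exact h2)
    have := hσ v.1 hv'
    rw [boxExt_apply_val] at this
    exact this
  · -- consistency
    intro A A' hAA' ζ E hE
    have hsub : A.map ι ⊆ A'.map ι := Finset.map_subset_map.2 hAA'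
    have hmeasA : Measurable fun σ' => boxSpec ρ β w x₀ m pad A σ' E := measurable_boxSpec_apply ρ hρ β x₀ m pad A hE
    simp only [boxSpec] at hmeasA ⊢
    rw [Measure.map_apply measurable_boxRestrict hE, lintegral_map hmeasA measurable_boxRestrict]
    have hprop := hγ.proper (A'.map ι) (boxExt w x₀ m pad ζ)
    have hE' : MeasurableSet (boxRestrict w x₀ m ⁻¹' E) := measurable_boxRestrict hE
    rw [← hγ.consistent hsub (boxExt w x₀ m pad ζ) _ hE']
    refine lintegral_congr_ae ?_
    filter_upwards [hprop] with σ hσ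
    have hfix : boxExt w x₀ m pad (boxRestrict w x₀ m σ) = σ := by
      refine boxExt_boxRestrict pad fun e he => ?_
      have heA : e ∉ A'.map ι := fun h => he (by
        obtain ⟨h1, -⟩ := (mem_map_subtype_iff x₀ m A' e).1 h
        exact h1)
      rw [hσ e heA, boxExt_apply_not_mem pad ζ he]
    rw [Measure.map_apply measurable_boxRestrict hE, hfix]

/-! ## §2 The block-Markov property -/

omit [T2Space G] in
include hρ hw in
/-- **Kernel expectations agree for exteriors agreeing near the volume.**  If two box exteriors agree on every box
link whose cell is within index distance `1` of a cell of the (cell-union) volume `A`, then the kernel expectations of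
every measurable observable reading only the volume and the agreeing links coincide. -/
theorem integral_boxSpec_eq_of_agree (A : Finset (BoxLink w x₀ m)) (ζ ζ' : BoxLink w x₀ m → G)
    (hagree : ∀ v : BoxLink w x₀ m, (∃ u ∈ A, cdist (boxCell w x₀ m n u) (boxCell w x₀ m n v) ≤ 1) → ζ v = ζ' v)
    {f : (BoxLink w x₀ m → G) → ℝ} (hfm : Measurable f) (hfdep : DependsOn f {v | v ∈ A ∨ ζ v = ζ' v}) :
    ∫ σ, f σ ∂(boxSpec ρ β w x₀ m pad A ζ) = ∫ σ, f σ ∂(boxSpec ρ β w x₀ m pad A ζ') := by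
  classical
  set ι : BoxLink w x₀ m ↪ ZdEdge 4 := Function.Embedding.subtype fun e => e ∈ boxEdges w x₀ m with hι
  -- the agreeing links, as a `ℤ⁴` edge set, carry `f ∘ boxRestrict`
  set S₀ : Finset (ZdEdge 4) := (Finset.univ.filter fun v : BoxLink w x₀ m => ζ v = ζ' v).map ι with hS₀
  have hAagree : ∀ v ∈ A, ζ v = ζ' v := fun v hv => hagree v ⟨v, hv, by rw [cdist_self]; exact zero_le_one⟩
  have hcyl : IsCylinder (fun U : LGConfig 4 G => f (boxRestrict w x₀ m U)) S₀ := by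
    intro U U' hUU'
    refine hfdep fun v hv => ?_
    have hv' : ζ v = ζ' v := by
      rcases hv with hv | hv
      · exact hAagree v hv
      · exact hv
    have hmem : v.1 ∈ S₀ := Finset.mem_map.2 ⟨v, Finset.mem_filter.2 ⟨Finset.mem_univ _, hv'⟩, rfl⟩
    exact hUU' v.1 (Finset.mem_coe.2 hmem)
  have hFm : Measurable fun U : LGConfig 4 G => f (boxRestrict w x₀ m U) := hfm.comp measurable_boxRestrict
  have hdep := dependsOn_integral_ymSpecification ρ hρ β (A.map ι) hFm hcyl
  rw [integral_boxSpec ρ β w x₀ m pad A ζ hfm, integral_boxSpec ρ β w x₀ m pad A ζ' hfm]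
  refine hdep fun e he => ?_
  rcases Finset.mem_union.1 (Finset.mem_coe.1 he) with he | he
  · -- an agreeing link
    obtain ⟨v, hv, rfl⟩ := Finset.mem_map.1 he
    have hv' := (Finset.mem_filter.1 hv).2
    simp only [hι, Function.Embedding.coe_subtype, boxExt_apply_val, hv']
  · -- an edge of a plaquette touching the volume: within sup-distance 1 of a link of `A`
    obtain ⟨e', he', hnear⟩ := exists_near_of_mem_collar he
    obtain ⟨u, hu, rfl⟩ := Finset.mem_map.1 he'
    by_cases heb : e ∈ boxEdges w x₀ m
    · rw [boxExt_apply_mem pad ζ heb, boxExt_apply_mem pad ζ' heb]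
      refine hagree ⟨e, heb⟩ ⟨u, hu, ?_⟩
      rw [cdist_boxCell hw, cellDist_le_iff]
      intro i
      have h := frame_hC1 hw e (ι u) hnear i
      rw [abs_sub_comm]
      simpa [hι] using h
    · exact boxExt_eq_of_not_mem pad ζ ζ' heb

omit [T2Space G] in
include hρ hw in
/-- **P2 — the box specification is block-Markov**: `HasBlockLeak (boxCell w x₀ m n) (boxSpec ρ β w x₀ m pad) 0 r`
for every `r` (ratio form with factor `exp 0 = 1`). -/
theorem hasBlockLeak_boxSpec (r : ℝ) : HasBlockLeak (boxCell w x₀ m n) (boxSpec ρ β w x₀ m pad) 0 r := by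
  intro A _ D ζ ζ' hagree f hfm _ hfdep
  rw [zero_mul, zero_mul, Real.exp_zero, one_mul]
  refine le_of_eq (integral_boxSpec_eq_of_agree ρ hρ β hw x₀ m n pad A ζ ζ' (fun v hv => hagree v ?_) hfm hfdep)
  obtain ⟨u, hu, hd⟩ := hv
  exact ⟨u, hu, hd.trans (by omega)⟩

end Spec

end Summit.QuantumFields.YangMills.Cruxes.IR.AfPincerUc.Port

end
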